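import Mathlib
import HarnessLib
import Summits.HubbardSuperconductivity.HubbardSuperconductivity.Theorems.KLProgrammeKLRegimeEngineTowerLevBridgeRho
import Summits.HubbardSuperconductivity.HubbardSuperconductivity.Theorems.KLProgrammeKLRegimeEngineKlScaleWtTranslate

/-!
# Route `KLProgramme` — crux K3 ENGINE (stmt-HubbardSuperconductivity-20437 `KLRegimeEngineV17F2`), stub (b) v2, THE LEVELS PACKAGE (ℓ), located-risk #10
# cure (ε), instantiation (I): the `ρ′`-currency bridge for the WEIGHTED oriented engine — `hNsw ⇐ hN` one level lower when the summand carries the scale tree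
# weight `klScaleWt … ((univ.image Y).image latticeLegPos)` (cell gate-hubbard-kl, seat hubbard-kl-k3c3-p2 g15; weighted twin of …TowerLevBridgeRho)

The oriented engine's top layer (`GrassmannWeightedEffectiveActionGradedTruncationOrientedDB`, k3c2-p3 g13) reads its vertices through
`(if Y ⊒ Ωe then ‖K Y‖·wt (univ.image Y) else 0)` for an arbitrary tree weight; at the tower `wt S = klScaleWt L M β j (S.image latticeLegPos)`.  Both factors
are translation invariant on the space-time torus — the kernel by conservation (`norm_sectorisedKernel_translate`), the weight by `klScaleWt_image_latticeLegPos_translate`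
— so the position-only pin again reads the full-pin datum ONE LEVEL LOWER.  The weighted levelled sizes have no named carrier in the tree (the doors take them as a
bound `B`), so the rows here are HYPOTHESIS TRANSFORMERS: from full-pin bounds `B (levelCount Ωe)` at every level to the swapped bounds.

* §1 `wtNorm_translate` — `klScaleWt(image (x + a, σ))·‖W_σ(x + a)‖ = klScaleWt(image (x, σ))·‖W_σ(x)‖` for a conserving `T`;
  **`wt_doorInputSw_of_doorInput`** (`(E, τ)` currency: the weighted door input may be pinned at ANY leg),
  **`wt_respects_posPin_le_of_fullPin`** (`ρ′` currency: `Ωe q = some _` ⇒ the weighted position-only-pin sum `≤ B (levelCount Ωe − 1)`),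
  `wt_respects_posPin_le_card_mul_of_fullPin` (crude, any `Ωe`: `≤ |Sec|·B (levelCount Ωe)`);
* §2 Γ-tuple currency over `K = kernel (sectorPreimage β F_J T) (m+1)` with the weight `wt (univ.image Y)`: `sum_ite_respects_kernel_sectorPreimage_wt_eq`,
  **`hN_respects_wt_of_fullPin`**, **`hNsw_respects_wt_of_fullPin`** (`∃ g ≥ 0`, `Σ_σ g σ ≤ ε_x·B (levelCount Ωe − 1)`), **`hNsw_respects_wt_card_of_fullPin`**.
Proofs only; nothing about the model is asserted; nothing asserts (ℓ), any stub, K3 or superconductivity.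
References: BGM 2006 §2.3 (2.17), §2.8 (2.88)–(2.90), (2.97)–(2.98), App. A4 (A4.8) [cite: BenfattoGiulianiMastropietro2006].
-/

noncomputable section

namespace Summit.HubbardSuperconductivity.HubbardSuperconductivity.Theorems.EngineV8

set_option linter.dupNamespace false -- summit = problem name (single-conjunct summit), D-0017

open Classical
open Real Finset Literature.MathematicalPhysics.QuantumLattice Literature.Probability.LatticeModels GrassmannAlgebra
open Literature.MathematicalPhysics.QuantumLattice.FermiRG
open Summit.HubbardSuperconductivity.HubbardSuperconductivity.Theorems.KLRegimeSplit
open Summit.HubbardSuperconductivity.HubbardSuperconductivity.Theorems.KLProgrammeLegKernels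
open Summit.HubbardSuperconductivity.HubbardSuperconductivity.Theorems.DispersionFlow
open Summit.HubbardSuperconductivity.HubbardSuperconductivity.Theorems.KLRegimeWick

variable {L M : ℕ} [NeZero L] [NeZero M]

/-! ## §1 The weighted summand is translation invariant; `(E, τ)` and `ρ′` currency transformers -/

/-- **The weighted summand of a conserving polynomial is translation invariant**: for a frequency– and momentum-conserving `T` (`β ≠ 0`) and the scale weight
read through `latticeLegPos`, `klScaleWt(image (x + a, σ))·‖W^{F}_σ(T)(x + a)‖ = klScaleWt(image (x, σ))·‖W^{F}_σ(T)(x)‖`. -/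
theorem wtNorm_translate {N : ℕ} {β : ℝ} (hβ : β ≠ 0) (F : Fin N → FreqMomentum L M → ℂ) (T : HubbardGrassmann L M)
    (hTf : ∀ (m : ℕ) (X : Fin m → HubbardFieldIdx L M),
      (∑ i, (if (X i).2 = 0 then (1 : ℤ) else -1) * matsubaraInt M (X i).1.1.1) ≠ 0 → kernel ℂ T m X = 0)
    (hT : ∀ (m : ℕ) (X : Fin m → HubbardFieldIdx L M), ∑ i, signedMomentum L (X i).2 (X i).1.1.2 ≠ 0 → kernel ℂ T m X = 0)
    (j m : ℕ) (σ : Fin m → SectorLeg N) (x : Fin m → SpaceTimeIdx L M) (a : SpaceTimeIdx L M) :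
    klScaleWt L M β j ((univ.image fun i => ((x i + a, σ i) : SpaceTimeIdx L M × SectorLeg N)).image (latticeLegPos (2 * (2 * M)))) *
        ‖sectorisedKernel L M β F T m σ (fun i => x i + a)‖ =
      klScaleWt L M β j ((univ.image fun i => ((x i, σ i) : SpaceTimeIdx L M × SectorLeg N)).image (latticeLegPos (2 * (2 * M)))) *
        ‖sectorisedKernel L M β F T m σ x‖ := by
  rw [klScaleWt_image_latticeLegPos_translate' β j x σ a]
  exact congrArg _ (norm_sectorisedKernel_translate hβ F T hTf hT m σ x a)

/-- **`(E, τ)` CURRENCY: the WEIGHTED door input of a conserving polynomial may be pinned at ANY leg** (`0 < β`): the standard weighted input bound at `|E| = F + 1 ∋ p`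
gives the same bound for every `E` with `|E| = F + 1` and EVERY pin leg `q`. [cite: BenfattoGiulianiMastropietro2006, App. A4 (A4.8)] -/
theorem wt_doorInputSw_of_doorInput {β : ℝ} (hβ : 0 < β) (μ : ℝ) (K : TrigPolyC4v) (J j : ℕ) (T : HubbardGrassmann L M)
    (hTf : ∀ (m : ℕ) (X : Fin m → HubbardFieldIdx L M),
      (∑ i, (if (X i).2 = 0 then (1 : ℤ) else -1) * matsubaraInt M (X i).1.1.1) ≠ 0 → kernel ℂ T m X = 0)
    (hT : ∀ (m : ℕ) (X : Fin m → HubbardFieldIdx L M), ∑ i, signedMomentum L (X i).2 (X i).1.1.2 ≠ 0 → kernel ℂ T m X = 0)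
    {m F : ℕ} {B : ℝ}
    (hB : ∀ (E : Finset (Fin (m + 1))) (τ : Fin (m + 1) → SectorLeg (sectorCount J)) (p : Fin (m + 1)), p ∈ E → E.card = F + 1 →
      ∀ y : SpaceTimeIdx L M,
        imagTimeWeight β M ^ m * ∑ σ ∈ univ.filter (fun σ : Fin (m + 1) → SectorLeg (sectorCount J) => ∀ e ∈ E, σ e = τ e),
          ∑ x ∈ univ.filter (fun x : Fin (m + 1) → SpaceTimeIdx L M => x p = y),
            klScaleWt L M β j ((univ.image fun i => ((x i, σ i) : SpaceTimeIdx L M × SectorLeg (sectorCount J))).image (latticeLegPos (2 * (2 * M)))) *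
              ‖sectorisedKernel L M β (klAnisoFamily L M β μ K klE0 J) T (m + 1) σ x‖ ≤ B)
    (E : Finset (Fin (m + 1))) (τ : Fin (m + 1) → SectorLeg (sectorCount J)) (hE : E.card = F + 1) (q : Fin (m + 1)) (y : SpaceTimeIdx L M) :
    imagTimeWeight β M ^ m * ∑ σ ∈ univ.filter (fun σ : Fin (m + 1) → SectorLeg (sectorCount J) => ∀ e ∈ E, σ e = τ e),
        ∑ x ∈ univ.filter (fun x : Fin (m + 1) → SpaceTimeIdx L M => x q = y),
          klScaleWt L M β j ((univ.image fun i => ((x i, σ i) : SpaceTimeIdx L M × SectorLeg (sectorCount J))).image (latticeLegPos (2 * (2 * M)))) *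
            ‖sectorisedKernel L M β (klAnisoFamily L M β μ K klE0 J) T (m + 1) σ x‖ ≤ B := by
  haveI : NeZero (2 * M) := ⟨by have := NeZero.ne M; omega⟩
  exact sum_posPinned_prescribedSum_le_of_prescribedSum_le
    (fun σ x => klScaleWt L M β j ((univ.image fun i => ((x i, σ i) : SpaceTimeIdx L M × SectorLeg (sectorCount J))).image
      (latticeLegPos (2 * (2 * M)))) * ‖sectorisedKernel L M β (klAnisoFamily L M β μ K klE0 J) T (m + 1) σ x‖)
    (fun σ x a => wtNorm_translate hβ.ne' _ T hTf hT j (m + 1) σ x a) hB E τ hE q y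

/-- **`ρ′` CURRENCY: the WEIGHTED position-only pin reads the full-pin bound ONE LEVEL LOWER** (`0 < β`, conserving `T`): if every full-pin weighted «respects» sum
at every level is `≤ B (levelCount Ωe′)`, then for `Ωe q = some _` and ANY leg `t`, the position-only-pin sum is `≤ B (levelCount Ωe − 1)`.
[cite: BenfattoGiulianiMastropietro2006, App. A4 (A4.8)] -/
theorem wt_respects_posPin_le_of_fullPin {β : ℝ} (hβ : 0 < β) (μ : ℝ) (K : TrigPolyC4v) (J j : ℕ) (T : HubbardGrassmann L M)
    (hTf : ∀ (m : ℕ) (X : Fin m → HubbardFieldIdx L M),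
      (∑ i, (if (X i).2 = 0 then (1 : ℤ) else -1) * matsubaraInt M (X i).1.1.1) ≠ 0 → kernel ℂ T m X = 0)
    (hT : ∀ (m : ℕ) (X : Fin m → HubbardFieldIdx L M), ∑ i, signedMomentum L (X i).2 (X i).1.1.2 ≠ 0 → kernel ℂ T m X = 0)
    {m : ℕ} (B : ℕ → ℝ)
    (hfull : ∀ (Ωe' : Fin (m + 1) → Option (SectorLeg (sectorCount J))) (t' : Fin (m + 1)) (s₀ : SectorLeg (sectorCount J)) (y : SpaceTimeIdx L M),
      imagTimeWeight β M ^ m *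
        ∑ σ ∈ univ.filter (fun σ : Fin (m + 1) → SectorLeg (sectorCount J) =>
            σ t' = s₀ ∧ ∀ (i : Fin (m + 1)) (s : SectorLeg (sectorCount J)), Ωe' i = some s → σ i = s),
          ∑ x ∈ univ.filter (fun x : Fin (m + 1) → SpaceTimeIdx L M => x t' = y),
            klScaleWt L M β j ((univ.image fun i => ((x i, σ i) : SpaceTimeIdx L M × SectorLeg (sectorCount J))).image (latticeLegPos (2 * (2 * M)))) *
              ‖sectorisedKernel L M β (klAnisoFamily L M β μ K klE0 J) T (m + 1) σ x‖ ≤ B (levelCount Ωe'))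
    (Ωe : Fin (m + 1) → Option (SectorLeg (sectorCount J))) {q : Fin (m + 1)} {sq : SectorLeg (sectorCount J)} (hq : Ωe q = some sq)
    (t : Fin (m + 1)) (y : SpaceTimeIdx L M) :
    imagTimeWeight β M ^ m *
        ∑ σ ∈ univ.filter (fun σ : Fin (m + 1) → SectorLeg (sectorCount J) =>
            ∀ (i : Fin (m + 1)) (s : SectorLeg (sectorCount J)), Ωe i = some s → σ i = s),
          ∑ x ∈ univ.filter (fun x : Fin (m + 1) → SpaceTimeIdx L M => x t = y),
            klScaleWt L M β j ((univ.image fun i => ((x i, σ i) : SpaceTimeIdx L M × SectorLeg (sectorCount J))).image (latticeLegPos (2 * (2 * M)))) *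
              ‖sectorisedKernel L M β (klAnisoFamily L M β μ K klE0 J) T (m + 1) σ x‖ ≤ B (levelCount Ωe - 1) := by
  haveI : NeZero (2 * M) := ⟨by have := NeZero.ne M; omega⟩
  have hlev : levelCount (Function.update Ωe q none) = levelCount Ωe - 1 := by
    have h := levelCount_update_none Ωe (q := q) (by rw [hq]; rfl)
    omega
  rw [sum_congr rfl fun σ _ => sum_filter_apply_eq_of_translate
    (fun x => klScaleWt L M β j ((univ.image fun i => ((x i, σ i) : SpaceTimeIdx L M × SectorLeg (sectorCount J))).image (latticeLegPos (2 * (2 * M)))) *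
      ‖sectorisedKernel L M β (klAnisoFamily L M β μ K klE0 J) T (m + 1) σ x‖)
    (fun x a => wtNorm_translate hβ.ne' _ T hTf hT j (m + 1) σ x a) t q y y, respects_filter_eq_update Ωe hq, ← hlev]
  exact hfull (Function.update Ωe q none) q sq y

omit [NeZero M] in
/-- **`ρ′` CURRENCY, CRUDE (any `Ωe`)**: the weighted position-only-pin sum is `≤ |SectorLeg (sectorCount J)| · B (levelCount Ωe)` (split over the pinned leg's sector).
-/
theorem wt_respects_posPin_le_card_mul_of_fullPin {β : ℝ} (μ : ℝ) (K : TrigPolyC4v) (J j : ℕ) (T : HubbardGrassmann L M) {m : ℕ} (B : ℕ → ℝ)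
    (hfull : ∀ (Ωe' : Fin (m + 1) → Option (SectorLeg (sectorCount J))) (t' : Fin (m + 1)) (s₀ : SectorLeg (sectorCount J)) (y : SpaceTimeIdx L M),
      imagTimeWeight β M ^ m *
        ∑ σ ∈ univ.filter (fun σ : Fin (m + 1) → SectorLeg (sectorCount J) =>
            σ t' = s₀ ∧ ∀ (i : Fin (m + 1)) (s : SectorLeg (sectorCount J)), Ωe' i = some s → σ i = s),
          ∑ x ∈ univ.filter (fun x : Fin (m + 1) → SpaceTimeIdx L M => x t' = y),
            klScaleWt L M β j ((univ.image fun i => ((x i, σ i) : SpaceTimeIdx L M × SectorLeg (sectorCount J))).image (latticeLegPos (2 * (2 * M)))) *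
              ‖sectorisedKernel L M β (klAnisoFamily L M β μ K klE0 J) T (m + 1) σ x‖ ≤ B (levelCount Ωe'))
    (Ωe : Fin (m + 1) → Option (SectorLeg (sectorCount J))) (t : Fin (m + 1)) (y : SpaceTimeIdx L M) :
    imagTimeWeight β M ^ m *
        ∑ σ ∈ univ.filter (fun σ : Fin (m + 1) → SectorLeg (sectorCount J) =>
            ∀ (i : Fin (m + 1)) (s : SectorLeg (sectorCount J)), Ωe i = some s → σ i = s),
          ∑ x ∈ univ.filter (fun x : Fin (m + 1) → SpaceTimeIdx L M => x t = y),
            klScaleWt L M β j ((univ.image fun i => ((x i, σ i) : SpaceTimeIdx L M × SectorLeg (sectorCount J))).image (latticeLegPos (2 * (2 * M)))) *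
              ‖sectorisedKernel L M β (klAnisoFamily L M β μ K klE0 J) T (m + 1) σ x‖ ≤
      Fintype.card (SectorLeg (sectorCount J)) * B (levelCount Ωe) := by
  rw [sum_respects_eq_sum_sum_fullPin _ Ωe t, mul_sum]
  calc ∑ s₀ : SectorLeg (sectorCount J), imagTimeWeight β M ^ m *
        ∑ σ ∈ univ.filter (fun σ : Fin (m + 1) → SectorLeg (sectorCount J) =>
            σ t = s₀ ∧ ∀ (i : Fin (m + 1)) (s : SectorLeg (sectorCount J)), Ωe i = some s → σ i = s),
          ∑ x ∈ univ.filter (fun x : Fin (m + 1) → SpaceTimeIdx L M => x t = y),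
            klScaleWt L M β j ((univ.image fun i => ((x i, σ i) : SpaceTimeIdx L M × SectorLeg (sectorCount J))).image (latticeLegPos (2 * (2 * M)))) *
              ‖sectorisedKernel L M β (klAnisoFamily L M β μ K klE0 J) T (m + 1) σ x‖
      ≤ ∑ _s₀ : SectorLeg (sectorCount J), B (levelCount Ωe) := sum_le_sum fun s₀ _ => hfull Ωe t s₀ y
    _ = Fintype.card (SectorLeg (sectorCount J)) * B (levelCount Ωe) := by rw [sum_const, card_univ, nsmul_eq_mul]

/-! ## §2 `Γ`-tuple currency with the weight `wt (univ.image Y)` -/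

omit [NeZero M] in
/-- The weighted «respects» sum of the sector preimage's kernel in the `(σ, x)` currency (`0 ≤ β`): for `K = kernel (sectorPreimage β F G) (m+1)`,
`Σ_{Y : Y t = a} (if Y ⊒ Ωe then ‖K Y‖·klScaleWt(image Y) else 0) = ε_x·(ε_x^m Σ_{σ : σ t = a.2, σ ⊒ Ωe} Σ_{x_t = a.1} klScaleWt(image (x,σ))·‖W_{F,σ}(x)‖)`. -/
theorem sum_ite_respects_kernel_sectorPreimage_wt_eq {N : ℕ} {β : ℝ} (hβ : 0 ≤ β) (F : Fin N → FreqMomentum L M → ℂ) (G : HubbardGrassmann L M) (j m : ℕ)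
    (Ωe : Fin (m + 1) → Option (SectorLeg N)) (t : Fin (m + 1)) (a : SpaceTimeIdx L M × SectorLeg N) :
    ∑ Y ∈ univ.filter (fun Y : Fin (m + 1) → SpaceTimeIdx L M × SectorLeg N => Y t = a),
        (if ∀ (i : Fin (m + 1)) (s : SectorLeg N), Ωe i = some s → (Y i).2 = s then
          ‖kernel ℂ (sectorPreimage β F G) (m + 1) Y‖ * klScaleWt L M β j ((univ.image Y).image (latticeLegPos (2 * (2 * M)))) else 0) =
      imagTimeWeight β M * (imagTimeWeight β M ^ m *
        ∑ σ ∈ univ.filter (fun σ : Fin (m + 1) → SectorLeg N => σ t = a.2 ∧ ∀ (i : Fin (m + 1)) (s : SectorLeg N), Ωe i = some s → σ i = s),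
          ∑ x ∈ univ.filter (fun x : Fin (m + 1) → SpaceTimeIdx L M => x t = a.1),
            klScaleWt L M β j ((univ.image fun i => ((x i, σ i) : SpaceTimeIdx L M × SectorLeg N)).image (latticeLegPos (2 * (2 * M)))) *
              ‖sectorisedKernel L M β F G (m + 1) σ x‖) := by
  have hε : 0 ≤ imagTimeWeight β M := imagTimeWeight_nonneg hβ M
  have hK : ∀ Y : Fin (m + 1) → SpaceTimeIdx L M × SectorLeg N,
      ‖kernel ℂ (sectorPreimage β F G) (m + 1) Y‖ * klScaleWt L M β j ((univ.image Y).image (latticeLegPos (2 * (2 * M)))) =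
        imagTimeWeight β M ^ (m + 1) *
          (klScaleWt L M β j ((univ.image fun i => (((Y i).1, (Y i).2) : SpaceTimeIdx L M × SectorLeg N)).image (latticeLegPos (2 * (2 * M)))) *
            ‖sectorisedKernel L M β F G (m + 1) (fun i => (Y i).2) (fun i => (Y i).1)‖) := by
    intro Y
    have himg : (univ.image fun i => (((Y i).1, (Y i).2) : SpaceTimeIdx L M × SectorLeg N)) = univ.image Y := by simp only [Prod.mk.eta]
    rw [himg, kernel_sectorPreimage_eq_sectorisedKernel β F G (m + 1) Y, norm_mul, norm_pow, Complex.norm_real, Real.norm_of_nonneg hε]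
    ring
  simp_rw [hK]
  rw [sum_ite_respects_fullPin_eq (fun σ x => imagTimeWeight β M ^ (m + 1) *
    (klScaleWt L M β j ((univ.image fun i => ((x i, σ i) : SpaceTimeIdx L M × SectorLeg N)).image (latticeLegPos (2 * (2 * M)))) *
      ‖sectorisedKernel L M β F G (m + 1) σ x‖)) Ωe t a]
  rw [← mul_assoc (imagTimeWeight β M) (imagTimeWeight β M ^ m), ← pow_succ', mul_sum]
  exact sum_congr rfl fun σ _ => by rw [mul_sum]

omit [NeZero M] in
/-- **WEIGHTED `hN` from the full-pin bounds** (any leg `t`, any `a`; `0 ≤ β`): `Σ_{Y : Y t = a} (if Y ⊒ Ωe then ‖K Y‖·wt(image Y) else 0) ≤ ε_x·B (levelCount Ωe)`. -/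
theorem hN_respects_wt_of_fullPin {β : ℝ} (hβ : 0 ≤ β) (μ : ℝ) (K : TrigPolyC4v) (J j : ℕ) (T : HubbardGrassmann L M) {m : ℕ} (B : ℕ → ℝ)
    (hfull : ∀ (Ωe' : Fin (m + 1) → Option (SectorLeg (sectorCount J))) (t' : Fin (m + 1)) (s₀ : SectorLeg (sectorCount J)) (y : SpaceTimeIdx L M),
      imagTimeWeight β M ^ m *
        ∑ σ ∈ univ.filter (fun σ : Fin (m + 1) → SectorLeg (sectorCount J) =>
            σ t' = s₀ ∧ ∀ (i : Fin (m + 1)) (s : SectorLeg (sectorCount J)), Ωe' i = some s → σ i = s),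
          ∑ x ∈ univ.filter (fun x : Fin (m + 1) → SpaceTimeIdx L M => x t' = y),
            klScaleWt L M β j ((univ.image fun i => ((x i, σ i) : SpaceTimeIdx L M × SectorLeg (sectorCount J))).image (latticeLegPos (2 * (2 * M)))) *
              ‖sectorisedKernel L M β (klAnisoFamily L M β μ K klE0 J) T (m + 1) σ x‖ ≤ B (levelCount Ωe'))
    (Ωe : Fin (m + 1) → Option (SectorLeg (sectorCount J))) (t : Fin (m + 1)) (a : SpaceTimeIdx L M × SectorLeg (sectorCount J)) :
    ∑ Y ∈ univ.filter (fun Y : Fin (m + 1) → SpaceTimeIdx L M × SectorLeg (sectorCount J) => Y t = a),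
        (if ∀ (i : Fin (m + 1)) (s : SectorLeg (sectorCount J)), Ωe i = some s → (Y i).2 = s then
          ‖kernel ℂ (sectorPreimage β (klAnisoFamily L M β μ K klE0 J) T) (m + 1) Y‖ * klScaleWt L M β j ((univ.image Y).image (latticeLegPos (2 * (2 * M))))
        else 0) ≤
      imagTimeWeight β M * B (levelCount Ωe) := by
  rw [sum_ite_respects_kernel_sectorPreimage_wt_eq hβ]
  exact mul_le_mul_of_nonneg_left (hfull Ωe t a.2 a.1) (imagTimeWeight_nonneg hβ M)

/-- **WEIGHTED `hNsw` from the full-pin bounds, ONE LEVEL LOWER** (`0 < β`, conserving `T`, `Ωe q = some _`, ANY leg `t`): `∃ g ≥ 0`, the weighted full-pin sums are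
`≤ g a.2`, and `Σ_{σ₀} g σ₀ ≤ ε_x·B (levelCount Ωe − 1)`. [cite: BenfattoGiulianiMastropietro2006, App. A4 (A4.8)] -/
theorem hNsw_respects_wt_of_fullPin {β : ℝ} (hβ : 0 < β) (μ : ℝ) (K : TrigPolyC4v) (J j : ℕ) (T : HubbardGrassmann L M)
    (hTf : ∀ (m : ℕ) (X : Fin m → HubbardFieldIdx L M),
      (∑ i, (if (X i).2 = 0 then (1 : ℤ) else -1) * matsubaraInt M (X i).1.1.1) ≠ 0 → kernel ℂ T m X = 0)
    (hT : ∀ (m : ℕ) (X : Fin m → HubbardFieldIdx L M), ∑ i, signedMomentum L (X i).2 (X i).1.1.2 ≠ 0 → kernel ℂ T m X = 0)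
    {m : ℕ} (B : ℕ → ℝ)
    (hfull : ∀ (Ωe' : Fin (m + 1) → Option (SectorLeg (sectorCount J))) (t' : Fin (m + 1)) (s₀ : SectorLeg (sectorCount J)) (y : SpaceTimeIdx L M),
      imagTimeWeight β M ^ m *
        ∑ σ ∈ univ.filter (fun σ : Fin (m + 1) → SectorLeg (sectorCount J) =>
            σ t' = s₀ ∧ ∀ (i : Fin (m + 1)) (s : SectorLeg (sectorCount J)), Ωe' i = some s → σ i = s),
          ∑ x ∈ univ.filter (fun x : Fin (m + 1) → SpaceTimeIdx L M => x t' = y),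
            klScaleWt L M β j ((univ.image fun i => ((x i, σ i) : SpaceTimeIdx L M × SectorLeg (sectorCount J))).image (latticeLegPos (2 * (2 * M)))) *
              ‖sectorisedKernel L M β (klAnisoFamily L M β μ K klE0 J) T (m + 1) σ x‖ ≤ B (levelCount Ωe'))
    (Ωe : Fin (m + 1) → Option (SectorLeg (sectorCount J))) {q : Fin (m + 1)} {sq : SectorLeg (sectorCount J)} (hq : Ωe q = some sq)
    (t : Fin (m + 1)) :
    ∃ g : SectorLeg (sectorCount J) → ℝ, (∀ σ₀, 0 ≤ g σ₀) ∧
      (∀ a : SpaceTimeIdx L M × SectorLeg (sectorCount J),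
        ∑ Y ∈ univ.filter (fun Y : Fin (m + 1) → SpaceTimeIdx L M × SectorLeg (sectorCount J) => Y t = a),
          (if ∀ (i : Fin (m + 1)) (s : SectorLeg (sectorCount J)), Ωe i = some s → (Y i).2 = s then
            ‖kernel ℂ (sectorPreimage β (klAnisoFamily L M β μ K klE0 J) T) (m + 1) Y‖ * klScaleWt L M β j ((univ.image Y).image (latticeLegPos (2 * (2 * M))))
          else 0) ≤ g a.2) ∧
      ∑ σ₀, g σ₀ ≤ imagTimeWeight β M * B (levelCount Ωe - 1) := by
  haveI : NeZero (2 * M) := ⟨by have := NeZero.ne M; omega⟩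
  have hε : 0 ≤ imagTimeWeight β M := imagTimeWeight_nonneg hβ.le M
  set F := klAnisoFamily L M β μ K klE0 J with hF
  set Φ : (Fin (m + 1) → SectorLeg (sectorCount J)) → (Fin (m + 1) → SpaceTimeIdx L M) → ℝ := fun σ x =>
    klScaleWt L M β j ((univ.image fun i => ((x i, σ i) : SpaceTimeIdx L M × SectorLeg (sectorCount J))).image (latticeLegPos (2 * (2 * M)))) *
      ‖sectorisedKernel L M β F T (m + 1) σ x‖ with hΦ
  set S : SectorLeg (sectorCount J) → SpaceTimeIdx L M → ℝ := fun s₀ y =>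
    imagTimeWeight β M ^ m *
      ∑ σ ∈ univ.filter (fun σ : Fin (m + 1) → SectorLeg (sectorCount J) =>
          σ t = s₀ ∧ ∀ (i : Fin (m + 1)) (s : SectorLeg (sectorCount J)), Ωe i = some s → σ i = s),
        ∑ x ∈ univ.filter (fun x : Fin (m + 1) → SpaceTimeIdx L M => x t = y), Φ σ x with hS
  have htr : ∀ (σ : Fin (m + 1) → SectorLeg (sectorCount J)) (x : Fin (m + 1) → SpaceTimeIdx L M) (a : SpaceTimeIdx L M),
      Φ σ (fun i => x i + a) = Φ σ x := fun σ x a => wtNorm_translate hβ.ne' F T hTf hT j (m + 1) σ x a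
  have hSy : ∀ s₀ y y', S s₀ y = S s₀ y' := by
    intro s₀ y y'
    simp only [hS]
    congr 1
    exact sum_congr rfl fun σ _ => sum_filter_apply_eq_of_translate (Φ σ) (htr σ) t t y y'
  refine ⟨fun s₀ => imagTimeWeight β M * S s₀ 0, fun s₀ => ?_, fun a => ?_, ?_⟩
  · refine mul_nonneg hε (mul_nonneg (pow_nonneg hε m) (sum_nonneg fun _ _ => sum_nonneg fun _ _ => ?_))
    exact mul_nonneg (zero_le_one.trans (one_le_klScaleWt L M β j _)) (norm_nonneg _)
  · rw [sum_ite_respects_kernel_sectorPreimage_wt_eq hβ.le]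
    change imagTimeWeight β M * S a.2 a.1 ≤ imagTimeWeight β M * S a.2 0
    rw [hSy a.2 a.1 0]
  · rw [← mul_sum]
    refine mul_le_mul_of_nonneg_left ?_ hε
    have hsplit := sum_respects_eq_sum_sum_fullPin
      (fun σ => ∑ x ∈ univ.filter (fun x : Fin (m + 1) → SpaceTimeIdx L M => x t = 0), Φ σ x) Ωe t
    have hpos := wt_respects_posPin_le_of_fullPin hβ μ K J j T hTf hT B hfull Ωe hq t (0 : SpaceTimeIdx L M)
    rw [← hF] at hpos
    change imagTimeWeight β M ^ m * ∑ σ ∈ _, ∑ x ∈ _, Φ σ x ≤ _ at hpos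
    rw [hsplit, mul_sum] at hpos
    exact hpos

omit [NeZero M] in
/-- **WEIGHTED `hNsw`, CRUDE (any `Ωe`, `0 ≤ β`)**: `∃ g ≥ 0`, weighted full pins `≤ g a.2`, `Σ_{σ₀} g σ₀ ≤ |SectorLeg (sectorCount J)|·ε_x·B (levelCount Ωe)` — with
`g σ₀ := ε_x·B (levelCount Ωe)` constant (no translation needed). -/
theorem hNsw_respects_wt_card_of_fullPin {β : ℝ} (hβ : 0 ≤ β) (μ : ℝ) (K : TrigPolyC4v) (J j : ℕ) (T : HubbardGrassmann L M) {m : ℕ} (B : ℕ → ℝ)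
    (hB0 : ∀ F, 0 ≤ B F)
    (hfull : ∀ (Ωe' : Fin (m + 1) → Option (SectorLeg (sectorCount J))) (t' : Fin (m + 1)) (s₀ : SectorLeg (sectorCount J)) (y : SpaceTimeIdx L M),
      imagTimeWeight β M ^ m *
        ∑ σ ∈ univ.filter (fun σ : Fin (m + 1) → SectorLeg (sectorCount J) =>
            σ t' = s₀ ∧ ∀ (i : Fin (m + 1)) (s : SectorLeg (sectorCount J)), Ωe' i = some s → σ i = s),
          ∑ x ∈ univ.filter (fun x : Fin (m + 1) → SpaceTimeIdx L M => x t' = y),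
            klScaleWt L M β j ((univ.image fun i => ((x i, σ i) : SpaceTimeIdx L M × SectorLeg (sectorCount J))).image (latticeLegPos (2 * (2 * M)))) *
              ‖sectorisedKernel L M β (klAnisoFamily L M β μ K klE0 J) T (m + 1) σ x‖ ≤ B (levelCount Ωe'))
    (Ωe : Fin (m + 1) → Option (SectorLeg (sectorCount J))) (t : Fin (m + 1)) :
    ∃ g : SectorLeg (sectorCount J) → ℝ, (∀ σ₀, 0 ≤ g σ₀) ∧
      (∀ a : SpaceTimeIdx L M × SectorLeg (sectorCount J),
        ∑ Y ∈ univ.filter (fun Y : Fin (m + 1) → SpaceTimeIdx L M × SectorLeg (sectorCount J) => Y t = a),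
          (if ∀ (i : Fin (m + 1)) (s : SectorLeg (sectorCount J)), Ωe i = some s → (Y i).2 = s then
            ‖kernel ℂ (sectorPreimage β (klAnisoFamily L M β μ K klE0 J) T) (m + 1) Y‖ * klScaleWt L M β j ((univ.image Y).image (latticeLegPos (2 * (2 * M))))
          else 0) ≤ g a.2) ∧
      ∑ σ₀, g σ₀ ≤ Fintype.card (SectorLeg (sectorCount J)) * (imagTimeWeight β M * B (levelCount Ωe)) := by
  have hε : 0 ≤ imagTimeWeight β M := imagTimeWeight_nonneg hβ M
  refine ⟨fun _ => imagTimeWeight β M * B (levelCount Ωe), fun _ => mul_nonneg hε (hB0 _), fun a => ?_, ?_⟩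
  · exact hN_respects_wt_of_fullPin hβ μ K J j T B hfull Ωe t a
  · rw [sum_const, card_univ, nsmul_eq_mul]

end Summit.HubbardSuperconductivity.HubbardSuperconductivity.Theorems.EngineV8
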